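import Literature.Probability.RandomPlanarGeometry.JordanIndexOne
import Literature.Topology.PlaneTopology.JordanSweepParity
import Literature.Topology.PlaneTopology.WindingReparam

/-!
# Welding continuity, part A: the indices of the two banks of a cross-cut

Support file for item `stmt-CriticalPhenomena-4509` (`SAWWeldingIdentification.WeldingContinuity`).

For a Jordan domain `Q` with boundary loop `β = Q.boundary`, parameters `m₀ < m₂ < m₀ + 1` and a
path `P` on `[0, 1]` from `β m₀` to `β m₂` (a cross-cut, but only continuity is used here), the
two **bank loops** are "`P`, then `β` backwards from `m₂` to `m₀`" and "`P`, then `β` forwards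
from `m₂` to `m₀ + 1`" (`concatPath`). Additivity of the argument increment (`logInc_concatPath`,
`wind_concatPath_mul`) and `wind_eq_wind_concatPath_subarc` give, for every point `z` off `P` and
off `∂Q`,

`wind (bankloop_L - z) - wind (bankloop_R - z) = - Q.index z`

(`wind_bankLoop_sub_wind_bankLoop`). This is the orientation bookkeeping behind the sign `s = ±1`
of the welding configurations: the two banks induce opposite orientations on the chord.

References: Ahlfors, *Complex Analysis* (1979), Ch. 4 §2.1 (winding numbers); Newman, *Elements of
the topology of plane sets of points* (1939), Ch. V §11 (cross-cuts).
-/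

noncomputable section

open Set Filter Metric Complex
open Literature.Probability.RandomPlanarGeometry Literature.Topology.PlaneTopology

namespace Summit.CriticalPhenomena.SAWScalingLimit.Theorems.WeldingContinuity

/-- Subtracting a constant commutes with `concatPath`. [folklore] -/
theorem concatPath_sub_const (P A : ℝ → ℂ) (z : ℂ) :
    (fun t => concatPath P A t - z) = concatPath (fun t => P t - z) (fun t => A t - z) := by
  have h := comp_concatPath (fun w => w - z) P A
  exact h

/-- A boundary sub-arc of a Jordan domain, affinely reparametrised and shifted by a point `z` off
the frontier, is a path in `ℂ ∖ {0}`. [folklore] -/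
theorem isNVPath_boundary_affine (Q : JordanDomain) (c d : ℝ) {z : ℂ}
    (hzQ : z ∉ frontier Q.carrier) :
    IsNVPath (fun u => Q.boundary (c + u * d) - z) := by
  refine ⟨?_, fun t _ => ?_⟩
  · exact ((Q.continuous_boundary.comp (by fun_prop)).sub continuous_const).continuousOn
  · exact sub_ne_zero.2 fun h => hzQ (h ▸ Q.boundary_mem_frontier _)

/-- **The winding numbers of the two bank loops differ by minus the index of the domain.** For a
Jordan domain `Q`, parameters `m₀ < m₂ < m₀ + 1`, a path `P` continuous on `[0, 1]` with
`P 0 = Q.boundary m₀`, `P 1 = Q.boundary m₂`, and a point `z` neither on `P([0,1])` nor on `∂Q`: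
`wind (L-loop - z) - wind (R-loop - z) = - Q.index z`, where the L-loop is `P` followed by the
boundary run backwards from `m₂` to `m₀` and the R-loop is `P` followed by the boundary run
forwards from `m₂` to `m₀ + 1`. (Both loops share `P`; the two boundary arcs together, with
orientations, make up minus the boundary loop.) [folklore] -/
theorem wind_bankLoop_sub_wind_bankLoop (Q : JordanDomain) {m₀ m₂ : ℝ} (h02 : m₀ < m₂)
    (h20 : m₂ < m₀ + 1) {P : ℝ → ℂ} (hPc : ContinuousOn P (Icc 0 1))
    (hP0 : P 0 = Q.boundary m₀) (hP1 : P 1 = Q.boundary m₂) {z : ℂ}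
    (hzP : ∀ t ∈ Icc (0 : ℝ) 1, P t ≠ z) (hzQ : z ∉ frontier Q.carrier) :
    wind (fun t => concatPath P (fun u => Q.boundary (m₂ + u * (m₀ - m₂))) t - z) -
      wind (fun t => concatPath P (fun u => Q.boundary (m₂ + u * (m₀ + 1 - m₂))) t - z) =
        -Q.index z := by
  -- the three pieces, shifted by `z`
  set f : ℝ → ℂ := fun t => P t - z with hf
  set gL : ℝ → ℂ := fun u => Q.boundary (m₂ + u * (m₀ - m₂)) - z with hgL
  set gR : ℝ → ℂ := fun u => Q.boundary (m₂ + u * (m₀ + 1 - m₂)) - z with hgR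
  have hfNV : IsNVPath f := ⟨hPc.sub continuousOn_const, fun t ht => sub_ne_zero.2 (hzP t ht)⟩
  have hgLNV : IsNVPath gL := isNVPath_boundary_affine Q m₂ (m₀ - m₂) hzQ
  have hgRNV : IsNVPath gR := isNVPath_boundary_affine Q m₂ (m₀ + 1 - m₂) hzQ
  have hbne : ∀ s, Q.boundary s - z ≠ 0 := fun s =>
    sub_ne_zero.2 fun h => hzQ (h ▸ Q.boundary_mem_frontier _)
  -- junctions
  have hfgL : f 1 = gL 0 := by simp only [hf, hgL, hP1]; ring_nf
  have hgLf : gL 1 = f 0 := by simp only [hf, hgL, hP0]; ring_nf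
  have hfgR : f 1 = gR 0 := by simp only [hf, hgR, hP1]; ring_nf
  have hgRf : gR 1 = f 0 := by
    simp only [hf, hgR, hP0]
    have : m₂ + 1 * (m₀ + 1 - m₂) = m₀ + 1 := by ring
    rw [this, Q.periodic_boundary]
  -- the two bank loops
  have hL : (wind (fun t => concatPath P (fun u => Q.boundary (m₂ + u * (m₀ - m₂))) t - z) : ℂ) *
      (2 * Real.pi * I) = logInc f + logInc gL := by
    rw [concatPath_sub_const]
    exact wind_concatPath_mul hfNV hgLNV hfgL hgLf
  have hR : (wind (fun t => concatPath P (fun u => Q.boundary (m₂ + u * (m₀ + 1 - m₂))) t - z) : ℂ) *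
      (2 * Real.pi * I) = logInc f + logInc gR := by
    rw [concatPath_sub_const]
    exact wind_concatPath_mul hfNV hgRNV hfgR hgRf
  -- the boundary loop of `Q`, cut at `m₂`
  set gL' : ℝ → ℂ := fun s => Q.boundary (m₀ + 1 + s * (m₂ + 1 - (m₀ + 1))) - z with hgL'
  have hgL'NV : IsNVPath gL' := isNVPath_boundary_affine Q (m₀ + 1) (m₂ + 1 - (m₀ + 1)) hzQ
  have hQ : (Q.index z : ℂ) * (2 * Real.pi * I) = logInc gR + logInc gL' := by
    have hW : Continuous fun t => Q.boundary t - z := Q.continuous_boundary.sub continuous_const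
    have hp : Function.Periodic (fun t => Q.boundary t - z) 1 := fun t => by
      simp only [Q.periodic_boundary t]
    have h1 := wind_eq_wind_concatPath_subarc hW hp hbne (t₁ := m₂) (t₂ := m₀ + 1) h20 (by linarith)
    have hgRgL' : gR 1 = gL' 0 := by simp only [hgR, hgL']; ring_nf
    have hgL'gR : gL' 1 = gR 0 := by
      simp only [hgR, hgL']
      have e1 : m₀ + 1 + 1 * (m₂ + 1 - (m₀ + 1)) = m₂ + 1 := by ring
      have e2 : m₂ + 0 * (m₀ + 1 - m₂) = m₂ := by ring
      rw [e1, e2, Q.periodic_boundary]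
    have h2 := wind_concatPath_mul hgRNV hgL'NV hgRgL' hgL'gR
    rw [JordanDomain.index, h1]
    exact h2
  -- the backward arc is the forward arc reversed
  have hrev : logInc gL' = -logInc gL := by
    rw [← logInc_reverse hgLNV.hasLogOn]
    congr 1
    funext t
    simp only [hgL, hgL']
    have e : m₀ + 1 + t * (m₂ + 1 - (m₀ + 1)) = m₂ + (1 - t) * (m₀ - m₂) + 1 := by ring
    rw [e, Q.periodic_boundary]
  -- combine
  have hI : (2 * (Real.pi : ℂ) * I) ≠ 0 := by
    apply mul_ne_zero (mul_ne_zero two_ne_zero (by exact_mod_cast Real.pi_ne_zero)) I_ne_zero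
  have key : ((wind (fun t => concatPath P (fun u => Q.boundary (m₂ + u * (m₀ - m₂))) t - z) : ℂ) -
      (wind (fun t => concatPath P (fun u => Q.boundary (m₂ + u * (m₀ + 1 - m₂))) t - z) : ℂ) +
      (Q.index z : ℂ)) * (2 * Real.pi * I) = 0 := by
    rw [add_mul, sub_mul, hL, hR, hQ, hrev]; ring
  have key' := (mul_eq_zero.1 key).resolve_right hI
  have key'' : ((wind (fun t => concatPath P (fun u => Q.boundary (m₂ + u * (m₀ - m₂))) t - z) -
      wind (fun t => concatPath P (fun u => Q.boundary (m₂ + u * (m₀ + 1 - m₂))) t - z) +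
      Q.index z : ℤ) : ℂ) = 0 := by push_cast; exact key'
  have := (Int.cast_eq_zero.1 key'')
  linarith

end Summit.CriticalPhenomena.SAWScalingLimit.Theorems.WeldingContinuity

end
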